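import Summits.SmoothPoincare4.SmoothPoincare4.Theses.ConvexBisection
import Summits.SmoothPoincare4.SmoothPoincare4.Theses.NoOneHandles
import Summits.SmoothPoincare4.SmoothPoincare4.Theorems.AcyclicBisectionRigidity.Negative.SeamCompatible
import Summits.SmoothPoincare4.SmoothPoincare4.Theorems.AcyclicBisectionRigidity.Negative.DoubleSector
import Summits.SmoothPoincare4.SmoothPoincare4.Theorems.ContractibleTwistedDoubleStandard.Negative.DoubleBisection
import Summits.SmoothPoincare4.SmoothPoincare4.Theorems.ConvexBisectionAcyclicBisectionRigidityStubPropertyRClosing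
import Summits.SmoothPoincare4.SmoothPoincare4.Theorems.ConvexBisectionAcyclicBisectionRigidityStubDoubleHalfContractible
import Summits.SmoothPoincare4.SmoothPoincare4.Theorems.ConvexBisectionAcyclicBisectionRigidityStubPropertyRRecognition
import Summits.SmoothPoincare4.SmoothPoincare4.Theorems.ConvexBisectionAcyclicBisectionRigidityStubResidualBall
import Summits.SmoothPoincare4.SmoothPoincare4.Theorems.ConvexBisectionAcyclicBisectionRigidityStubMazurDouble
import Summits.SmoothPoincare4.SmoothPoincare4.Theorems.ConvexBisectionAcyclicBisectionRigiditySeamGluingCrux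
import Literature.Geometry.Symplectic.SteinHandlebodies
import Summits.SmoothPoincare4.SmoothPoincare4.Theorems.ConvexBisectionAcyclicBisectionRigidityGscLeverCertificates
import Literature.Topology.FourManifolds.HomotopyS4CompactProofs
import Literature.Topology.FourManifolds.HomotopyS4OrientableProofs
import Literature.Topology.FourManifolds.MorseProofs
import HarnessLib

/-!
# The reduction of crux `ConvexBisection.AcyclicBisectionRigidity` along line `seam-duality-cancellation`
# (item stmt-SmoothPoincare4-10507, route route-SmoothPoincare4-ConvexBisection; lead c4)

Sorry-free REDUCTION FILE of the line (`--supports stmt-SmoothPoincare4-10507`).  The merged carrier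
skeleton of the crux (`Cruxes/AcyclicBisectionRigidity/Lines/seam_duality_cancellation.lean`, reshape s7,
leads a1-1 / c1 / c2 / c3 / c4) composes seven `sorry`d stubs into the crux BY NAME; four of them are
named literature facts (C = Cerf `Γ₄ = 0`, E = Eliashberg's filling theorem, R∧L∧T = Property R +
Laudenbach–Poénaru + the trace bridge, M = Mazur's theorem), two are existing open items in costume
(`stub_gscClosing` ⊂ item stmt-SmoothPoincare4-0377 `NoOneHandles.NoohGscStandard`; `stub_nonMazurSteinDoubles`
⊂ item stmt-SmoothPoincare4-3546 `ConvexBisection.ContractibleTwistedDoubleStandard`) and one is the line's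
apex, the GSC LEVER `stub_gscOfNonDouble` (a non-double, non-disc acyclic common-contact Stein bisection
of a homotopy 4-sphere is geometrically simply connected).  This file turns that composition into
importable tree theorems whose hypotheses are those statements VERBATIM, so that the exact logical
position of the crux along this line is one kernel-checked implication rather than a 1300-line workfile:

* `helper_reduction_of_items` — **crux 2 ⇐ GSC lever ∧ item 0377 ∧ item 3546, and nothing else.**  With
  item 0377 in hand (EVERY homotopy 4-sphere carrying a Morse function without index-1 critical points is
  `S⁴`, any number of index-2 points) no literature fact is needed at all: a disc-type half makes `M`
  geometrically simply connected outright (the landed `helper_gscOfDiscTypeHalf`, p115012, re-proved privately here: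
  Gompf's 2-handlebody theorem + c1's seam gluing), a seam-compatible twin makes `M` a double of the ℚ-acyclic, hence contractible
  (landed `stub_doubleHalfContractible`), Stein half `W₁`, which item 3546 covers through the landed
  `Negative.double_standard_of_crux`, and the remaining sector is the lever's.
* `helper_reduction_iff_doubleSector` — the sharp form: **modulo item 0377 ALONE, crux 2 ⇔ (double sector) ∧
  (GSC lever)**, where the double sector is VERBATIM conjunct (1) of the landed three-sector decomposition
  `Negative.crux_iff_threeSectors` (every homotopy-sphere `IsDouble` of one compact ℚ-acyclic Stein domain is
  `S⁴`; implied by the crux, `Negative.doubleSector_of_crux`).  So, given route NoOneHandles' crux C2, the GSC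
  lever is EXACTLY the cork-twist and non-twin sectors of crux 2 in handle form.
* `helper_reduction_of_residuals` — **the skeleton's composition itself**, with its seven stubs as
  hypotheses: GSC lever ∧ `stub_gscClosing` (only `c₂ ≥ 2`) ∧ `stub_nonMazurSteinDoubles` (only non-Mazur,
  non-disc contractible Stein doubles) ∧ C ∧ E ∧ R ∧ L ∧ T ∧ M ⟹ crux 2.  It records what the six named
  facts BUY relative to `helper_reduction_of_items`: E + C make the disc sector unconditional (landed
  `stub_residualBall`), C + R + L + T the closings with `c₂ ≤ 1` (landed `stub_propertyR_recognition`,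
  `ExchangeRecognition.stub_propertyRClosing_noTwoHandle`), M the Mazur-type doubles (landed
  `stub_mazurDouble`) — shrinking the two item-shaped residuals to the slices the skeleton registers.

Everything here is pure logic over landed theorems; no definitions, no `sorry`.  When the three open
statements are proved (as registered stubs or as their items), `ConvexBisection.AcyclicBisectionRigidity`
follows by `exact helper_reduction_of_items hGSC NoohGscStandard_holds ContractibleTwistedDoubleStandard_holds`.

## References

* R. Gompf, *Handlebody construction of Stein surfaces*, Ann. of Math. 148 (1998), Thm. 1.3 (a). [Gompf1998]
* R. Gompf, M. Scharlemann, A. Thompson, Geom. Topol. 14 (2010), §9, Prop. 9.2. [GompfScharlemannThompson2010]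
* R. Kirby, *Problems in low-dimensional topology* (1997), Problems 4.18, 1.82. [Kirby1997]
-/

noncomputable section

-- The namespace is prescribed by the crux protocol (`Summit.<P>.<Sub>.Theorems.<Crux>.<Line>`
-- with `P = Sub = SmoothPoincare4`), hence the duplicated component.
set_option linter.dupNamespace false

open scoped Manifold ContDiff Topology ContinuousMap
open Set Function
open Literature.Geometry.Symplectic Literature.AlgebraicTopology.SingularHomology CategoryTheory.Limits
open Literature.Topology.FourManifolds

namespace Summit.SmoothPoincare4.SmoothPoincare4.Theorems.AcyclicBisectionRigidity.SeamDualityCancellation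

open Summit.SmoothPoincare4.SmoothPoincare4.Theses
open Summit.SmoothPoincare4.SmoothPoincare4.Theorems.AcyclicBisectionRigidity.ExchangeRecognition
  (stub_propertyRClosing_noTwoHandle stub_doubleHalfContractible)
open Summit.SmoothPoincare4.SmoothPoincare4.Theorems.AcyclicBisectionRigidity.SeamGluing
  (exists_isMorse_of_steinBisection_of_hasHandleDecomposition)
open Summit.SmoothPoincare4.SmoothPoincare4.Theorems.AcyclicBisectionRigidity.Negative
  (isDouble_of_seamCompatible doubleSector_of_crux)
open Summit.SmoothPoincare4.SmoothPoincare4.Theorems.ContractibleTwistedDoubleStandard.Negative (double_standard_of_crux)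


/-- The disc sub-sector of the GSC lever (private copy of the landed `helper_gscOfDiscTypeHalf`, p115012,
`Theorems/ConvexBisectionAcyclicBisectionRigidityGscDiscSector.lean`, whose module is imported here once the farm has built it):
under the crux data without acyclicity, a disc-type FIRST half makes `M` geometrically simply connected — the Stein half `W₂` is a
2-handlebody (Gompf 1998 Thm. 1.3 (a), `Gompf1998_thm13_indexLE_two_holds`), and the glued function of
`SeamGluing.exists_isMorse_of_steinBisection_of_hasHandleDecomposition` (lead c1) has `#Crit_1 = c₁ 1 + c₂ 3 = 0 + 0`.
[cite: Gompf1998, Thm. 1.3 (a)] -/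
private theorem gsc_of_discTypeHalf_aux
    (M : Type) [TopologicalSpace M] [T2Space M] [SecondCountableTopology M] [ChartedSpace (EuclideanSpace ℝ (Fin 4)) M]
    [IsManifold (𝓡 4) ∞ M] (hM : M ≃ₕ Metric.sphere (0 : EuclideanSpace ℝ (Fin 5)) 1)
    (W₁ : Type) [TopologicalSpace W₁] [ChartedSpace (EuclideanHalfSpace 4) W₁] [IsManifold (𝓡∂ 4) ∞ W₁]
    [CompactSpace W₁] (W₂ : Type) [TopologicalSpace W₂] [ChartedSpace (EuclideanHalfSpace 4) W₂]
    [IsManifold (𝓡∂ 4) ∞ W₂] [CompactSpace W₂] (J₁ : SteinStructure W₁) (J₂ : SteinStructure W₂)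
    (e₁ : W₁ → M) (e₂ : W₂ → M)
    (he₁ : Manifold.IsSmoothEmbedding (𝓡∂ 4) (𝓡 4) ∞ e₁)
    (he₂ : Manifold.IsSmoothEmbedding (𝓡∂ 4) (𝓡 4) ∞ e₂)
    (hcover : range e₁ ∪ range e₂ = univ)
    (hseam₁ : range e₁ ∩ range e₂ = e₁ '' (𝓡∂ 4).boundary W₁)
    (hseam₂ : range e₁ ∩ range e₂ = e₂ '' (𝓡∂ 4).boundary W₂)
    (hξ : ∀ w₁ w₂, e₁ w₁ = e₂ w₂ →
      Submodule.map (mfderiv (𝓡∂ 4) (𝓡 4) e₁ w₁).toLinearMap (contactPlane J₁.J w₁) =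
      Submodule.map (mfderiv (𝓡∂ 4) (𝓡 4) e₂ w₂).toLinearMap (contactPlane J₂.J w₂))
    (h₁ : HasHandleDecomposition 3 W₁ (fun k => if k = 0 then 1 else 0)) :
    ∃ F : M → ℝ, IsMorse (𝓡 4) F ∧ criticalSetOfIndex (𝓡 4) F 1 = ∅ := by
  haveI : CompactSpace M := compactSpace_of_homotopyEquiv_sphere_four_holds M hM
  haveI : T2Space W₂ := he₂.isEmbedding.t2Space
  haveI : SecondCountableTopology W₂ := he₂.isEmbedding.secondCountableTopology
  -- the Stein half `W₂` is a 2-handlebody: an adapted Morse function with indices `≤ 2`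
  obtain ⟨f₂, hf₂, hf₂i⟩ := Gompf1998_thm13_indexLE_two_holds.of_steinStructure W₂ J₂
  have hf₂' : IsMorseAdapted (𝓡∂ 4) f₂ := hf₂
  have h₂ : HasHandleDecomposition 3 W₂ (fun k => (criticalSetOfIndex (𝓡∂ 4) f₂ k).ncard) :=
    ⟨f₂, hf₂', fun _ => rfl⟩
  have h₂3 : (criticalSetOfIndex (𝓡∂ 4) f₂ 3).ncard = 0 := by
    have hfin : (criticalSetOfIndex (𝓡∂ 4) f₂ 3).Finite :=
      (IsMorse.finite_criticalSet_holds hf₂'.isMorse).subset (criticalSetOfIndex_subset _ f₂ 3)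
    rw [Set.ncard_eq_zero hfin]
    refine Set.eq_empty_of_forall_notMem fun x hx => ?_
    have hle : morseIndex (𝓡∂ 4) f₂ x ≤ 2 := hf₂i x hx.1
    rw [hx.2] at hle
    omega
  -- glue across the seam: `#Crit_1 = c₁ 1 + c₂ 3 = 0`
  obtain ⟨F, hF, hcount⟩ := exists_isMorse_of_steinBisection_of_hasHandleDecomposition M hM W₁ W₂ J₁ J₂ e₁ e₂
    he₁ he₂ hcover hseam₁ hseam₂ hξ h₁ h₂
  have h1 : (criticalSetOfIndex (𝓡 4) F 1).ncard = 0 := by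
    rw [hcount 1 3 rfl, h₂3]
    simp
  have hfin1 : (criticalSetOfIndex (𝓡 4) F 1).Finite :=
    (IsMorse.finite_criticalSet_holds hF).subset (criticalSetOfIndex_subset _ F 1)
  exact ⟨F, hF, (Set.ncard_eq_zero hfin1).1 h1⟩

/-- **Crux 2 from the GSC lever and the two items 0377, 3546 — no literature fact needed.**
Hypotheses: `hGSC`, VERBATIM the registered apex stub `stub_gscOfNonDouble` of the carrier skeleton (crux data +
no seam-compatible twin + neither half disc-type ⇒ `M` carries a Morse function without index-1 critical points);
`h0377 : NoOneHandles.NoohGscStandard` (item stmt-SmoothPoincare4-0377: a homotopy 4-sphere with a Morse function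
without index-1 critical points is `S⁴`); `h3546 : ConvexBisection.ContractibleTwistedDoubleStandard` (item
stmt-SmoothPoincare4-3546: common-contact Stein bisections with contractible halves are `S⁴`).  Proof, three sectors:
(1) a disc-type half ⇒ `M` geometrically simply connected (the landed `helper_gscOfDiscTypeHalf`, p115012; private copy
`gsc_of_discTypeHalf_aux` here, applied to both orders of the halves) ⇒ item 0377
(`M` packaged as a `HomotopySphere 4`: compact and orientable by the PROVED `compactSpace_of_homotopyEquiv_sphere_four_holds`,
`isOrientable_of_homotopyEquiv_sphere_four_holds`); (2) a seam-compatible twin `Φ : W₁ ≅ W₂` ⇒ `M` is an `IsDouble` of `W₁`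
(`Negative.isDouble_of_seamCompatible`), `W₁` is contractible (`ExchangeRecognition.stub_doubleHalfContractible`, p89382:
retract of a homotopy sphere + ℚ-acyclic), so item 3546 applies (`Negative.double_standard_of_crux`); (3) otherwise the
lever gives the 1-handle-free Morse function and item 0377 concludes. [cite: Kirby1997, Problems 4.18 and 1.82] -/
theorem helper_reduction_of_items
    (hGSC : ∀ (M : Type) [TopologicalSpace M] [T2Space M] [SecondCountableTopology M]
      [ChartedSpace (EuclideanSpace ℝ (Fin 4)) M] [IsManifold (𝓡 4) ∞ M]
      (_hM : M ≃ₕ Metric.sphere (0 : EuclideanSpace ℝ (Fin 5)) 1)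
      (W₁ : Type) [TopologicalSpace W₁] [ChartedSpace (EuclideanHalfSpace 4) W₁] [IsManifold (𝓡∂ 4) ∞ W₁]
      [CompactSpace W₁] (W₂ : Type) [TopologicalSpace W₂] [ChartedSpace (EuclideanHalfSpace 4) W₂]
      [IsManifold (𝓡∂ 4) ∞ W₂] [CompactSpace W₂] (J₁ : SteinStructure W₁) (J₂ : SteinStructure W₂)
      (e₁ : W₁ → M) (e₂ : W₂ → M)
      (_he₁ : Manifold.IsSmoothEmbedding (𝓡∂ 4) (𝓡 4) ∞ e₁)
      (_he₂ : Manifold.IsSmoothEmbedding (𝓡∂ 4) (𝓡 4) ∞ e₂)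
      (_hcover : range e₁ ∪ range e₂ = univ)
      (_hseam₁ : range e₁ ∩ range e₂ = e₁ '' (𝓡∂ 4).boundary W₁)
      (_hseam₂ : range e₁ ∩ range e₂ = e₂ '' (𝓡∂ 4).boundary W₂)
      (_hξ : ∀ w₁ w₂, e₁ w₁ = e₂ w₂ →
        Submodule.map (mfderiv (𝓡∂ 4) (𝓡 4) e₁ w₁).toLinearMap (contactPlane J₁.J w₁) =
        Submodule.map (mfderiv (𝓡∂ 4) (𝓡 4) e₂ w₂).toLinearMap (contactPlane J₂.J w₂))
      (_hac : ∀ k, 0 < k → IsZero (singularHomology ℚ ℚ W₁ k) ∧ IsZero (singularHomology ℚ ℚ W₂ k))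
      (_hnd : ¬ ∃ Φ : W₁ ≃ₘ⟮𝓡∂ 4, 𝓡∂ 4⟯ W₂, ∀ w, w ∈ (𝓡∂ 4).boundary W₁ → e₂ (Φ w) = e₁ w)
      (_hB : ¬ (HasHandleDecomposition 3 W₁ (fun k => if k = 0 then 1 else 0) ∨
        HasHandleDecomposition 3 W₂ (fun k => if k = 0 then 1 else 0))),
      ∃ F : M → ℝ, IsMorse (𝓡 4) F ∧ criticalSetOfIndex (𝓡 4) F 1 = ∅)
    (h0377 : NoOneHandles.NoohGscStandard) (h3546 : ConvexBisection.ContractibleTwistedDoubleStandard) :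
    ConvexBisection.AcyclicBisectionRigidity := by
  intro M _ _ _ _ _ hM hb
  obtain ⟨W₁, _, _, _, _, W₂, _, _, _, _, J₁, J₂, e₁, e₂, he₁, he₂, hcover, hseam₁, hseam₂, hξ, hac⟩ := hb
  haveI : T2Space W₁ := he₁.isEmbedding.t2Space
  haveI : SecondCountableTopology W₁ := he₁.isEmbedding.secondCountableTopology
  haveI : CompactSpace M := compactSpace_of_homotopyEquiv_sphere_four_holds M hM
  obtain ⟨o⟩ := isOrientable_of_homotopyEquiv_sphere_four_holds M hM
  -- item 0377 closes every geometrically simply connected `M`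
  have finish : ∀ F : M → ℝ, IsMorse (𝓡 4) F → criticalSetOfIndex (𝓡 4) F 1 = ∅ →
      Nonempty (M ≃ₘ⟮𝓡 4, 𝓡 4⟯ Metric.sphere (0 : EuclideanSpace ℝ (Fin 5)) 1) :=
    fun F hF h1 => h0377 ⟨M, o, ⟨hM⟩⟩ F hF h1
  -- (1) DISC-TYPE HALF: geometrically simply connected outright
  by_cases hB : HasHandleDecomposition 3 W₁ (fun k => if k = 0 then 1 else 0) ∨
      HasHandleDecomposition 3 W₂ (fun k => if k = 0 then 1 else 0)
  · rcases hB with h₁ | h₂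
    · obtain ⟨F, hF, h1⟩ := gsc_of_discTypeHalf_aux M hM W₁ W₂ J₁ J₂ e₁ e₂ he₁ he₂ hcover hseam₁ hseam₂ hξ h₁
      exact finish F hF h1
    · -- the crux data is symmetric in the two halves
      have hcover' : range e₂ ∪ range e₁ = univ := by rw [union_comm]; exact hcover
      have hseam₁' : range e₂ ∩ range e₁ = e₂ '' (𝓡∂ 4).boundary W₂ := by rw [inter_comm]; exact hseam₂
      have hseam₂' : range e₂ ∩ range e₁ = e₁ '' (𝓡∂ 4).boundary W₁ := by rw [inter_comm]; exact hseam₁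
      have hξ' : ∀ w₂ w₁, e₂ w₂ = e₁ w₁ →
          Submodule.map (mfderiv (𝓡∂ 4) (𝓡 4) e₂ w₂).toLinearMap (contactPlane J₂.J w₂) =
          Submodule.map (mfderiv (𝓡∂ 4) (𝓡 4) e₁ w₁).toLinearMap (contactPlane J₁.J w₁) :=
        fun w₂ w₁ h => (hξ w₁ w₂ h.symm).symm
      obtain ⟨F, hF, h1⟩ := gsc_of_discTypeHalf_aux M hM W₂ W₁ J₂ J₁ e₂ e₁ he₂ he₁ hcover' hseam₁' hseam₂' hξ' h₂
      exact finish F hF h1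
  -- (2) DOUBLE SECTOR: a seam-compatible twin presents `M` as a double of the contractible `W₁`
  by_cases hs : ∃ Φ : W₁ ≃ₘ⟮𝓡∂ 4, 𝓡∂ 4⟯ W₂, ∀ w, w ∈ (𝓡∂ 4).boundary W₁ → e₂ (Φ w) = e₁ w
  · obtain ⟨Φ, hΦ⟩ := hs
    obtain ⟨b⟩ := nonempty_boundaryData_holds 3 W₁
    have hD : IsDouble b (𝓡 4) M := isDouble_of_seamCompatible he₁ he₂ hcover hseam₁ Φ hΦ b
    haveI : ContractibleSpace W₁ := stub_doubleHalfContractible W₁ (fun k hk => (hac k hk).1) b M hD hM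
    exact double_standard_of_crux h3546 W₁ J₁ b M hD
  -- (3) NON-DOUBLE, NON-DISC: the GSC lever, then item 0377
  obtain ⟨F, hF, h1⟩ := hGSC M hM W₁ W₂ J₁ J₂ e₁ e₂ he₁ he₂ hcover hseam₁ hseam₂ hξ hac hs hB
  exact finish F hF h1

/-- **The sharp position: modulo item 0377 alone, crux 2 ⇔ (double sector) ∧ (GSC lever).**  The double sector is VERBATIM
conjunct (1) of the landed `Negative.crux_iff_threeSectors` (every `IsDouble` of one compact ℚ-acyclic Stein domain which is a
homotopy 4-sphere is `S⁴`).  `→`: `Negative.doubleSector_of_crux` and the certificate `gscOfNonDouble_of_crux`.  `←`: a disc-type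
half or the lever's sector give a 1-handle-free Morse function, closed by item 0377; a seam-compatible twin makes `M` an `IsDouble`
of the ℚ-acyclic `W₁` (`Negative.isDouble_of_seamCompatible`), closed by the double-sector hypothesis — no contractibility, no item
3546 and no literature fact are used.  Hence, given crux C2 of route NoOneHandles, the GSC lever is exactly the cork-twist and
non-twin sectors of crux 2 in handle form. [cite: Kirby1997, Problems 4.18 and 1.82] -/
theorem helper_reduction_iff_doubleSector (h0377 : NoOneHandles.NoohGscStandard) :
    ConvexBisection.AcyclicBisectionRigidity ↔
      ((∀ (W : Type) [TopologicalSpace W] [ChartedSpace (EuclideanHalfSpace 4) W]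
          [IsManifold (𝓡∂ 4) ∞ W] [CompactSpace W] (_J : SteinStructure W)
          (b : BoundaryData (𝓡∂ 4) W (𝓡 3))
          (P : Type) [TopologicalSpace P] [T2Space P] [SecondCountableTopology P]
          [ChartedSpace (EuclideanSpace ℝ (Fin 4)) P] [IsManifold (𝓡 4) ∞ P],
          IsDouble b (𝓡 4) P → (∀ k, 0 < k → IsZero (singularHomology ℚ ℚ W k)) →
          P ≃ₕ Metric.sphere (0 : EuclideanSpace ℝ (Fin 5)) 1 →
          Nonempty (P ≃ₘ⟮𝓡 4, 𝓡 4⟯ Metric.sphere (0 : EuclideanSpace ℝ (Fin 5)) 1)) ∧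
      (∀ (M : Type) [TopologicalSpace M] [T2Space M] [SecondCountableTopology M]
        [ChartedSpace (EuclideanSpace ℝ (Fin 4)) M] [IsManifold (𝓡 4) ∞ M]
        (_hM : M ≃ₕ Metric.sphere (0 : EuclideanSpace ℝ (Fin 5)) 1)
        (W₁ : Type) [TopologicalSpace W₁] [ChartedSpace (EuclideanHalfSpace 4) W₁] [IsManifold (𝓡∂ 4) ∞ W₁]
        [CompactSpace W₁] (W₂ : Type) [TopologicalSpace W₂] [ChartedSpace (EuclideanHalfSpace 4) W₂]
        [IsManifold (𝓡∂ 4) ∞ W₂] [CompactSpace W₂] (J₁ : SteinStructure W₁) (J₂ : SteinStructure W₂)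
        (e₁ : W₁ → M) (e₂ : W₂ → M)
        (_he₁ : Manifold.IsSmoothEmbedding (𝓡∂ 4) (𝓡 4) ∞ e₁)
        (_he₂ : Manifold.IsSmoothEmbedding (𝓡∂ 4) (𝓡 4) ∞ e₂)
        (_hcover : range e₁ ∪ range e₂ = univ)
        (_hseam₁ : range e₁ ∩ range e₂ = e₁ '' (𝓡∂ 4).boundary W₁)
        (_hseam₂ : range e₁ ∩ range e₂ = e₂ '' (𝓡∂ 4).boundary W₂)
        (_hξ : ∀ w₁ w₂, e₁ w₁ = e₂ w₂ →
          Submodule.map (mfderiv (𝓡∂ 4) (𝓡 4) e₁ w₁).toLinearMap (contactPlane J₁.J w₁) =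
          Submodule.map (mfderiv (𝓡∂ 4) (𝓡 4) e₂ w₂).toLinearMap (contactPlane J₂.J w₂))
        (_hac : ∀ k, 0 < k → IsZero (singularHomology ℚ ℚ W₁ k) ∧ IsZero (singularHomology ℚ ℚ W₂ k))
        (_hnd : ¬ ∃ Φ : W₁ ≃ₘ⟮𝓡∂ 4, 𝓡∂ 4⟯ W₂, ∀ w, w ∈ (𝓡∂ 4).boundary W₁ → e₂ (Φ w) = e₁ w)
        (_hB : ¬ (HasHandleDecomposition 3 W₁ (fun k => if k = 0 then 1 else 0) ∨
          HasHandleDecomposition 3 W₂ (fun k => if k = 0 then 1 else 0))),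
        ∃ F : M → ℝ, IsMorse (𝓡 4) F ∧ criticalSetOfIndex (𝓡 4) F 1 = ∅)) := by
  refine ⟨fun h => ⟨fun W _ _ _ _ J b P _ _ _ _ _ hD hac hP => doubleSector_of_crux h W J b hac P hD hP, ?_⟩,
    fun ⟨hDS, hGSC⟩ => ?_⟩
  · intro M _ _ _ _ _ hM W₁ _ _ _ _ W₂ _ _ _ _ J₁ J₂ e₁ e₂ he₁ he₂ hcover hseam₁ hseam₂ hξ hac hnd _
    exact gscOfNonDouble_of_crux h M hM W₁ W₂ J₁ J₂ e₁ e₂ he₁ he₂ hcover hseam₁ hseam₂ hξ hac hnd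
  intro M _ _ _ _ _ hM hb
  obtain ⟨W₁, _, _, _, _, W₂, _, _, _, _, J₁, J₂, e₁, e₂, he₁, he₂, hcover, hseam₁, hseam₂, hξ, hac⟩ := hb
  haveI : T2Space W₁ := he₁.isEmbedding.t2Space
  haveI : SecondCountableTopology W₁ := he₁.isEmbedding.secondCountableTopology
  haveI : CompactSpace M := compactSpace_of_homotopyEquiv_sphere_four_holds M hM
  obtain ⟨o⟩ := isOrientable_of_homotopyEquiv_sphere_four_holds M hM
  -- item 0377 closes every geometrically simply connected `M`
  have finish : ∀ F : M → ℝ, IsMorse (𝓡 4) F → criticalSetOfIndex (𝓡 4) F 1 = ∅ →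
      Nonempty (M ≃ₘ⟮𝓡 4, 𝓡 4⟯ Metric.sphere (0 : EuclideanSpace ℝ (Fin 5)) 1) :=
    fun F hF h1 => h0377 ⟨M, o, ⟨hM⟩⟩ F hF h1
  -- (1) DISC-TYPE HALF
  by_cases hB : HasHandleDecomposition 3 W₁ (fun k => if k = 0 then 1 else 0) ∨
      HasHandleDecomposition 3 W₂ (fun k => if k = 0 then 1 else 0)
  · rcases hB with h₁ | h₂
    · obtain ⟨F, hF, h1⟩ := gsc_of_discTypeHalf_aux M hM W₁ W₂ J₁ J₂ e₁ e₂ he₁ he₂ hcover hseam₁ hseam₂ hξ h₁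
      exact finish F hF h1
    · have hcover' : range e₂ ∪ range e₁ = univ := by rw [union_comm]; exact hcover
      have hseam₁' : range e₂ ∩ range e₁ = e₂ '' (𝓡∂ 4).boundary W₂ := by rw [inter_comm]; exact hseam₂
      have hseam₂' : range e₂ ∩ range e₁ = e₁ '' (𝓡∂ 4).boundary W₁ := by rw [inter_comm]; exact hseam₁
      have hξ' : ∀ w₂ w₁, e₂ w₂ = e₁ w₁ →
          Submodule.map (mfderiv (𝓡∂ 4) (𝓡 4) e₂ w₂).toLinearMap (contactPlane J₂.J w₂) =
          Submodule.map (mfderiv (𝓡∂ 4) (𝓡 4) e₁ w₁).toLinearMap (contactPlane J₁.J w₁) :=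
        fun w₂ w₁ h => (hξ w₁ w₂ h.symm).symm
      obtain ⟨F, hF, h1⟩ := gsc_of_discTypeHalf_aux M hM W₂ W₁ J₂ J₁ e₂ e₁ he₂ he₁ hcover' hseam₁' hseam₂' hξ' h₂
      exact finish F hF h1
  -- (2) DOUBLE SECTOR: a seam-compatible twin presents `M` as a double of the ℚ-acyclic `W₁`
  by_cases hs : ∃ Φ : W₁ ≃ₘ⟮𝓡∂ 4, 𝓡∂ 4⟯ W₂, ∀ w, w ∈ (𝓡∂ 4).boundary W₁ → e₂ (Φ w) = e₁ w
  · obtain ⟨Φ, hΦ⟩ := hs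
    obtain ⟨b⟩ := nonempty_boundaryData_holds 3 W₁
    have hD : IsDouble b (𝓡 4) M := isDouble_of_seamCompatible he₁ he₂ hcover hseam₁ Φ hΦ b
    exact hDS W₁ J₁ b M hD (fun k hk => (hac k hk).1) hM
  -- (3) NON-DOUBLE, NON-DISC: the GSC lever, then item 0377
  obtain ⟨F, hF, h1⟩ := hGSC M hM W₁ W₂ J₁ J₂ e₁ e₂ he₁ he₂ hcover hseam₁ hseam₂ hξ hac hs hB
  exact finish F hF h1

/-- **The carrier skeleton's composition, stubs as hypotheses** (reshape s7 `AcyclicBisectionRigidity_of`, verbatim): the GSC lever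
`hGSC`, the two item-shaped residuals `hClosing` (VERBATIM `stub_gscClosing`: a homotopy 4-sphere with a 1-handle-free Morse function
with AT LEAST TWO index-2 critical points is `S⁴` — the `c₂ ≥ 2` slice of item 0377) and `hND` (VERBATIM `stub_nonMazurSteinDoubles`:
homotopy-sphere doubles of compact contractible Stein domains with neither a Mazur-type `(1,1,1)` nor a disc-type handle
decomposition are `S⁴` — a slice of item 3546 / item 3717), and the six named literature facts C (`cerf_twistedSphere_four`),
E (`Eliashberg1990_steinFilling_sphere_three`), R (`isUnknot_of_isIntegralSurgery_zero`), L (`exists_diffeomorph_comp_incl_eq.{0}`),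
T (`exists_framedKnot_of_hasHandleDecomposition_oneZeroOne`), M (`Mazur1961_double_sphere_four`) imply crux 2.  Relative to
`helper_reduction_of_items` the facts buy: the disc sector unconditionally (E, C: landed `stub_residualBall`), the closings with
`c₂ = 0` (C: twisted sphere, landed `ExchangeRecognition.stub_propertyRClosing_noTwoHandle`) and `c₂ = 1` (C, R, L, T: landed
`stub_propertyR_recognition`), and the Mazur-type doubles (M: landed `stub_mazurDouble`).
[cite: GompfScharlemannThompson2010, Prop. 9.2] [cite: Kirby1997, Problems 4.18 and 1.82] -/
theorem helper_reduction_of_residuals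
    (hGSC : ∀ (M : Type) [TopologicalSpace M] [T2Space M] [SecondCountableTopology M]
      [ChartedSpace (EuclideanSpace ℝ (Fin 4)) M] [IsManifold (𝓡 4) ∞ M]
      (_hM : M ≃ₕ Metric.sphere (0 : EuclideanSpace ℝ (Fin 5)) 1)
      (W₁ : Type) [TopologicalSpace W₁] [ChartedSpace (EuclideanHalfSpace 4) W₁] [IsManifold (𝓡∂ 4) ∞ W₁]
      [CompactSpace W₁] (W₂ : Type) [TopologicalSpace W₂] [ChartedSpace (EuclideanHalfSpace 4) W₂]
      [IsManifold (𝓡∂ 4) ∞ W₂] [CompactSpace W₂] (J₁ : SteinStructure W₁) (J₂ : SteinStructure W₂)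
      (e₁ : W₁ → M) (e₂ : W₂ → M)
      (_he₁ : Manifold.IsSmoothEmbedding (𝓡∂ 4) (𝓡 4) ∞ e₁)
      (_he₂ : Manifold.IsSmoothEmbedding (𝓡∂ 4) (𝓡 4) ∞ e₂)
      (_hcover : range e₁ ∪ range e₂ = univ)
      (_hseam₁ : range e₁ ∩ range e₂ = e₁ '' (𝓡∂ 4).boundary W₁)
      (_hseam₂ : range e₁ ∩ range e₂ = e₂ '' (𝓡∂ 4).boundary W₂)
      (_hξ : ∀ w₁ w₂, e₁ w₁ = e₂ w₂ →
        Submodule.map (mfderiv (𝓡∂ 4) (𝓡 4) e₁ w₁).toLinearMap (contactPlane J₁.J w₁) =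
        Submodule.map (mfderiv (𝓡∂ 4) (𝓡 4) e₂ w₂).toLinearMap (contactPlane J₂.J w₂))
      (_hac : ∀ k, 0 < k → IsZero (singularHomology ℚ ℚ W₁ k) ∧ IsZero (singularHomology ℚ ℚ W₂ k))
      (_hnd : ¬ ∃ Φ : W₁ ≃ₘ⟮𝓡∂ 4, 𝓡∂ 4⟯ W₂, ∀ w, w ∈ (𝓡∂ 4).boundary W₁ → e₂ (Φ w) = e₁ w)
      (_hB : ¬ (HasHandleDecomposition 3 W₁ (fun k => if k = 0 then 1 else 0) ∨
        HasHandleDecomposition 3 W₂ (fun k => if k = 0 then 1 else 0))),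
      ∃ F : M → ℝ, IsMorse (𝓡 4) F ∧ criticalSetOfIndex (𝓡 4) F 1 = ∅)
    (hClosing : ∀ (M : Type) [TopologicalSpace M] [T2Space M] [SecondCountableTopology M]
      [ChartedSpace (EuclideanSpace ℝ (Fin 4)) M] [IsManifold (𝓡 4) ∞ M]
      (_hM : M ≃ₕ Metric.sphere (0 : EuclideanSpace ℝ (Fin 5)) 1)
      (F : M → ℝ) (_hF : IsMorse (𝓡 4) F) (_h1 : criticalSetOfIndex (𝓡 4) F 1 = ∅)
      (_h2 : 1 < (criticalSetOfIndex (𝓡 4) F 2).ncard),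
      Nonempty (M ≃ₘ⟮𝓡 4, 𝓡 4⟯ Metric.sphere (0 : EuclideanSpace ℝ (Fin 5)) 1))
    (hND : ∀ (W : Type) [TopologicalSpace W] [T2Space W] [SecondCountableTopology W]
      [ChartedSpace (EuclideanHalfSpace 4) W] [IsManifold (𝓡∂ 4) ∞ W] [CompactSpace W] [ContractibleSpace W]
      (_S : SteinStructure W)
      (_hnM : ¬ HasHandleDecomposition 3 W (fun k => if k ≤ 2 then 1 else 0))
      (_hnD : ¬ HasHandleDecomposition 3 W (fun k => if k = 0 then 1 else 0))
      (b : BoundaryData (𝓡∂ 4) W (𝓡 3))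
      (P : Type) [TopologicalSpace P] [T2Space P] [SecondCountableTopology P]
      [ChartedSpace (EuclideanSpace ℝ (Fin 4)) P] [IsManifold (𝓡 4) ∞ P]
      (_hP : P ≃ₕ Metric.sphere (0 : EuclideanSpace ℝ (Fin 5)) 1) (_hD : IsDouble b (𝓡 4) P),
      Nonempty (P ≃ₘ⟮𝓡 4, 𝓡 4⟯ Metric.sphere (0 : EuclideanSpace ℝ (Fin 5)) 1))
    (hC : cerf_twistedSphere_four) (hE : Eliashberg1990_steinFilling_sphere_three)
    (hPR : isUnknot_of_isIntegralSurgery_zero) (hLP : exists_diffeomorph_comp_incl_eq.{0})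
    (hT : exists_framedKnot_of_hasHandleDecomposition_oneZeroOne) (hMazur : Mazur1961_double_sphere_four) :
    ConvexBisection.AcyclicBisectionRigidity := by
  intro M _ _ _ _ _ hM hb
  obtain ⟨W₁, _, _, _, _, W₂, _, _, _, _, J₁, J₂, e₁, e₂, he₁, he₂, hcover, hseam₁, hseam₂, hξ, hac⟩ := hb
  -- the crux data is symmetric in the two halves
  have hcover' : range e₂ ∪ range e₁ = univ := by rw [union_comm]; exact hcover
  have hseam₁' : range e₂ ∩ range e₁ = e₂ '' (𝓡∂ 4).boundary W₂ := by rw [inter_comm]; exact hseam₂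
  have hseam₂' : range e₂ ∩ range e₁ = e₁ '' (𝓡∂ 4).boundary W₁ := by rw [inter_comm]; exact hseam₁
  have hξ' : ∀ w₂ w₁, e₂ w₂ = e₁ w₁ →
      Submodule.map (mfderiv (𝓡∂ 4) (𝓡 4) e₂ w₂).toLinearMap (contactPlane J₂.J w₂) =
      Submodule.map (mfderiv (𝓡∂ 4) (𝓡 4) e₁ w₁).toLinearMap (contactPlane J₁.J w₁) :=
    fun w₂ w₁ h => (hξ w₁ w₂ h.symm).symm
  haveI : T2Space W₁ := he₁.isEmbedding.t2Space
  haveI : SecondCountableTopology W₁ := he₁.isEmbedding.secondCountableTopology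
  haveI : CompactSpace M := compactSpace_of_homotopyEquiv_sphere_four_holds M hM
  -- (1) DISC-TYPE HALF (E, C)
  by_cases hB : HasHandleDecomposition 3 W₁ (fun k => if k = 0 then 1 else 0) ∨
      HasHandleDecomposition 3 W₂ (fun k => if k = 0 then 1 else 0)
  · rcases hB with h₁ | h₂
    · exact stub_residualBall hE hC M hM W₁ W₂ J₁ J₂ e₁ e₂ he₁ he₂ hcover hseam₁ hseam₂ hξ h₁
    · exact stub_residualBall hE hC M hM W₂ W₁ J₂ J₁ e₂ e₁ he₂ he₁ hcover' hseam₁' hseam₂' hξ' h₂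
  -- the closing of a geometrically simply connected homotopy sphere, split three ways by the number `c₂` of 2-handles
  have finish : ∀ F : M → ℝ, IsMorse (𝓡 4) F → criticalSetOfIndex (𝓡 4) F 1 = ∅ →
      Nonempty (M ≃ₘ⟮𝓡 4, 𝓡 4⟯ Metric.sphere (0 : EuclideanSpace ℝ (Fin 5)) 1) := fun F hF h1 => by
    by_cases h2 : (criticalSetOfIndex (𝓡 4) F 2).ncard ≤ 1
    · rcases Nat.le_one_iff_eq_zero_or_eq_one.1 h2 with h20 | h21
      · -- `c₂ = 0`: twisted sphere, Cerf
        have hfin2 : (criticalSetOfIndex (𝓡 4) F 2).Finite :=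
          (IsMorse.finite_criticalSet_holds hF).subset (criticalSetOfIndex_subset _ F 2)
        exact stub_propertyRClosing_noTwoHandle hC M hM F hF h1 ((Set.ncard_eq_zero hfin2).1 h20)
      · -- `c₂ = 1`: Property R
        exact stub_propertyR_recognition hC hPR hLP hT M hM F hF h1 h21
    · -- `c₂ ≥ 2`: the residual `hClosing`
      exact hClosing M hM F hF h1 (by omega)
  -- (2) DOUBLE SECTOR: a seam-compatible twin presents `M` as a double of `W₁`
  by_cases hs : ∃ Φ : W₁ ≃ₘ⟮𝓡∂ 4, 𝓡∂ 4⟯ W₂, ∀ w, w ∈ (𝓡∂ 4).boundary W₁ → e₂ (Φ w) = e₁ w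
  · obtain ⟨Φ, hΦ⟩ := hs
    obtain ⟨b⟩ := nonempty_boundaryData_holds 3 W₁
    have hD : IsDouble b (𝓡 4) M := isDouble_of_seamCompatible he₁ he₂ hcover hseam₁ Φ hΦ b
    by_cases h₁ : HasHandleDecomposition 3 W₁ (fun k => if k ≤ 2 then 1 else 0)
    · exact stub_mazurDouble hMazur W₁ J₁ h₁ (fun k hk => (hac k hk).1) b M hM hD
    · haveI : ContractibleSpace W₁ := stub_doubleHalfContractible W₁ (fun k hk => (hac k hk).1) b M hD hM
      exact hND W₁ J₁ h₁ (fun h => hB (Or.inl h)) b M hM hD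
  -- (3) NON-DOUBLE, NON-DISC: the GSC lever, then the three-way closing
  obtain ⟨F, hF, h1⟩ := hGSC M hM W₁ W₂ J₁ J₂ e₁ e₂ he₁ he₂ hcover hseam₁ hseam₂ hξ hac hs hB
  exact finish F hF h1

end Summit.SmoothPoincare4.SmoothPoincare4.Theorems.AcyclicBisectionRigidity.SeamDualityCancellation

end
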